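import Mathlib.MeasureTheory.Measure.FiniteMeasurePi
import Literature.MathematicalPhysics.QuantumLattice.LatticeScalarFieldGriffithsProofs
import Literature.Probability.LatticeModels.IsingLimitLawPhi4Proofs
import Literature.Probability.LatticeModels.IsingLimitLawTilt
import Literature.Probability.Distributions.GaussianPiDensity
import HarnessLib

/-!
# Griffiths–Simon approximation of lattice `φ⁴` measures by block Ising systems (coupled systems)

Proofs-only companion of `LatticeScalarField.lean` (topic `Literature/MathematicalPhysics/QuantumLattice`):
no statement of the tree is changed, **no definition and no named fact is introduced** — every
declaration below is a theorem. It supplies the first step of Aizenman–Duminil-Copin's own proof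
line for the `φ⁴` case of their triviality theorem (Ann. Math. 194 (2021), Thm 1.2 via Thm 7.1 /
Prop. 7.2, the tree's fact `Literature.MathematicalPhysics.QuantumFieldTheory.phi44_triviality` and
its barrier alias `Literature.Barriers.QuantumFields.ScalarPhi4Triviality`): §2, p. 7 — "In this
representation, any system of `φ⁴` variables associated with the sites of a graph `𝒱`, and coupled
through the graph's edges, is presentable as the limit (`N → ∞`) of a system of constituent Ising
spins associated with the Cartesian graph product `ℤᵈ × 𝒦_N`" — which §7 (p. 28) uses in the form
"we identify `⟨·⟩_{ρ,β}` with the Ising measure, and `τₓ` with the proper average of Ising's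
variables … many of the basic diagrammatic bounds which are available for the Ising model extend to
the GS class essentially by linearity, and then to the GS class by continuity". The tree had the
single-site half of this (Simon–Griffiths 1973, Thm 1: `isIsingLimitLaw_phi4_holds`, the law
`Z₁⁻¹ e^{-g u⁴ - κ u²} du` is a weak limit of block magnetization laws `isingMagnetizationLaw n K w`
with `K ≥ 0`, `w ≥ 0` and Gaussian-exponential moments bounded along the sequence) but not the
passage to the COUPLED system `latticeFieldMeasure G ν J = Z⁻¹ e^{J ∑_{xy} φₓφ_y} ν^{⊗V}` /
`phi4Measure G g κ J` of `LatticeScalarField.lean`, which is what makes finite-graph Ising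
inequalities (random currents with edge-dependent couplings, `Literature/Probability/LatticeModels`)
available for lattice `φ⁴`.

## Contents (all proved)

* `tendsto_integral_of_sq_integral_le`, `tendsto_integral_of_abs_le_of_sq_integral_le` — weak
  convergence of probability laws on a general topological space plus a uniform bound
  `∫ H² dν_k ≤ B` gives `∫ F dν_k → ∫ F dν₀` for continuous `|F| ≤ H` (truncation; the tree's
  `Literature.Probability.LatticeModels.tendsto_integral_of_tendsto_of_sq_le` is the case `X = ℝ`,
  `F ≥ 0`).
* `tendsto_pi_of_tendsto` (Mathlib `ProbabilityMeasure.continuous_pi`),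
  `integral_exp_mul_sum_sq_pi`, `tendsto_integral_pi_of_tendsto` — if `ν_k → ν₀` weakly on `ℝ`
  with `sup_k ∫ e^{b u²} dν_k < ∞` for all `b`, then `∫ F dν_k^{⊗V} → ∫ F dν₀^{⊗V}` for every
  continuous `F : (V → ℝ) → ℝ` with `|F(φ)| ≤ C e^{b ∑ₓ φₓ²}`.
* `integral_latticeFieldMeasure` (expectations are ratios `∫ F e^{J∑φφ} dν^{⊗V} / ∫ e^{J∑φφ} dν^{⊗V}`),
  `exp_mul_pairInteraction_le` (Gaussian domination of the coupling weight),
  `isProbabilityMeasure_latticeFieldMeasure`, and the transfer theorem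
  **`tendsto_integral_latticeFieldMeasure`**: under the same hypotheses,
  `∫ F d(latticeFieldMeasure G ν_k J) → ∫ F d(latticeFieldMeasure G ν₀ J)` for every real `J`.
* Identification: `tilted_eq_smul_withDensity` (a tilted measure is the normalised density
  measure — the shape in which `isIsingLimitLaw_phi4` writes the single-site law), `pi_tilted`
  (`⊗ₓ(μ tilted by h) = μ^{⊗V}` tilted by `∑ₓ h(φₓ)`), `latticeFieldMeasure_tilted_volume`, and
  **`latticeFieldMeasure_phi4SiteLaw`**: `phi4Measure G g κ J = latticeFieldMeasure G ν_{g,κ} J`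
  with `ν_{g,κ} = volume.tilted (u ↦ -g u⁴ - κ u²)` (`g > 0`).
* **`exists_blockIsing_tendsto_integral_phi4Measure`**: for `g > 0` and all real `κ`, `J` there are
  `n_k`, `K_k ≥ 0`, `w_k ≥ 0` with
  `∫ F d(latticeFieldMeasure G (isingMagnetizationLaw n_k K_k w_k) J) → ∫ F d(phi4Measure G g κ J)`
  for every continuous `F` of Gaussian-exponential growth; `integral_phi4Measure_le_of_blockIsing`
  (inequalities linear in the expectation transfer from the block-Ising laws to `φ⁴`).
* The approximants ARE ferromagnetic Ising models on `V × Fin n`: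
  `integral_pi_isingMagnetizationLaw`, **`integral_latticeFieldMeasure_isingMagnetizationLaw`**
  (`∫ F = ∑_s F(τ(s)) e^{-ℋ(s)} / ∑_s e^{-ℋ(s)}` over `s : V → Fin n → Bool`,
  `-ℋ(s) = ∑ₓ ∑ᵢⱼ Kᵢⱼ s_{x,i}s_{x,j} + J ∑_{xy ∈ E(G)} τₓ(s)τ_y(s)`, `τₓ(s) = ∑ᵢ wᵢ s_{x,i}`) and
  `weightedMagnetization_mul_weightedMagnetization` (the inter-block term is the pair interaction
  with couplings `J wᵢ wⱼ`).

## What is NOT here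

Nothing of ADC §3–§7 proper (random currents for the block system, Thm 7.1, Prop. 7.2), no
infinite-volume limit, and no dictionary between the coupling-matrix Ising systems of
`IsingLimitLaw.lean` (`isingPairPMF` on `Fin m`) and the graph Ising measures / weighted random
currents of `Literature/Probability/LatticeModels` (`isingMeasure`, `WeightedCurrents`): a user
transferring a specific random-current inequality to `phi4Measure` applies it to the Gibbs sum of
`integral_latticeFieldMeasure_isingMagnetizationLaw` on the graph with vertex set `V × Fin n`.

## Sources

* M. Aizenman, H. Duminil-Copin, *Marginal triviality of the scaling limits of critical 4D Ising
  and `φ⁴₄` models*, Ann. Math. 194 (2021) 163–235, arXiv:1912.07973 (read: arXiv text): §2,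
  Def. 2.1 and the paragraph after it (p. 7); §7, first paragraph (p. 28); §1.2 (p. 4, the Gibbs
  states with a-priori measure `ρ(dφ) = e^{-λφ⁴+bφ²}dφ`). [AizenmanDuminilCopinAnnals2021]
* B. Simon, R. B. Griffiths, *The `(φ⁴)₂` field theory as a classical Ising model*, Comm. Math.
  Phys. 33 (1973) 145–164, §2 Thm 1 (single-site approximation; discharged in the tree as
  `isIsingLimitLaw_phi4_holds`) and its use for coupled lattice systems in §§2–3 (not held; cited
  through ADC §2 and the tree's discharge). [SimonGriffiths1973]
* P. Billingsley, *Convergence of Probability Measures* (2nd ed. 1999), Thm 3.5 (uniform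
  integrability and convergence of moments) — the truncation lemma.

## Mathlib

`ProbabilityMeasure.continuous_pi`, `ProbabilityMeasure.tendsto_iff_forall_integral_tendsto`,
`integral_tilted`, `tilted_tilted`, `tilted_apply'`, `isProbabilityMeasure_tilted`, `integral_exp_pos`,
`Measure.pi_eq`, `Measure.restrict_pi_pi`, `Measure.pi_map_pi`, `Measure.pi_singleton`,
`integral_fintype`, `integral_fintype_prod_eq_pow`, `Integrable.fintype_prod`, `PMF.toMeasure_map`,
`PMF.toMeasure_apply_singleton`. From the tree: `latticeFieldMeasure`, `phi4Measure`, `phi4Action`,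
`pairInteraction`, `abs_pairInteraction_le` (`LatticeScalarField[Proofs]`), `isingMagnetizationLaw`,
`IsIsingLimitLaw`, `isIsingLimitLaw_phi4_holds`, `SimonGriffiths.integrable_phi4Density`
(`IsingLimitLaw[Phi4Proofs]`, `CurieWeissDensity`),
`Literature.Probability.Distributions.lintegral_fin_nat_prod_eq_prod` (`GaussianPiDensity`).

## Design

* Sequences indexed by `ℕ` and `atTop` throughout (that is what `IsIsingLimitLaw` provides).
* Growth class: continuous `F` with `|F(φ)| ≤ C e^{b ∑ₓ φₓ²}`; it contains all polynomials and all
  `e^{∑ aₓ φₓ}`, and is what the moment clause of `IsIsingLimitLaw` controls after tilting by the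
  quadratic form `J ∑_{xy} φₓ φ_y` (`|∑_{xy} φₓφ_y| ≤ #E(G) ∑ φ²`).
* The single-site `φ⁴` law is written `volume.tilted (u ↦ -g u⁴ - κ u²)`, definitionally
  convenient for `tilted_tilted`; `tilted_eq_smul_withDensity` converts it to the literal shape of
  `isIsingLimitLaw_phi4`. No `def` is introduced for it.
* `J` is arbitrary real in the convergence statements; ferromagnetism (`J ≥ 0`, `K ≥ 0`, `w ≥ 0`)
  matters only for the Ising inequalities a user feeds in (`integral_phi4Measure_le_of_blockIsing`).
-/

noncomputable section

open MeasureTheory Filter Topology Finset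
open scoped ENNReal BoundedContinuousFunction

namespace Literature.MathematicalPhysics.QuantumLattice

/-! ### Weak limits and observables with a uniform second-moment bound -/

section WeakLimits

variable {X : Type*} [TopologicalSpace X] [MeasurableSpace X] [OpensMeasurableSpace X]

/-- **Truncation.** If probability laws `ν_k → ν₀` weakly on a topological space and a
continuous `F ≥ 0` has `∫ F² dν_k ≤ B` eventually, then `F` is `ν₀`-integrable and
`∫ F dν_k → ∫ F dν₀` (weak convergence on the bounded truncations `F ∧ M`, a uniform tail
bound `∫ (F - F ∧ M) ≤ B/M`, monotone convergence at the limit). This is the tree's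
`Literature.Probability.LatticeModels.tendsto_integral_of_tendsto_of_sq_le` (stated there on `ℝ`)
on a general space; the proof is the same. (Billingsley, *Convergence of Probability Measures*,
2nd ed., Thm 3.5 and (3.18): uniform integrability from a uniform higher-moment bound.) [folklore] -/
theorem tendsto_integral_of_sq_integral_le {ν : ℕ → ProbabilityMeasure X}
    {ν₀ : ProbabilityMeasure X} (hν : Tendsto ν atTop (𝓝 ν₀)) {F : X → ℝ} (hF : Continuous F)
    (hF0 : ∀ x, 0 ≤ F x) {B : ℝ}
    (hB : ∀ᶠ k in atTop, Integrable (fun x => F x ^ 2) (ν k : Measure X) ∧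
      ∫ x, F x ^ 2 ∂(ν k : Measure X) ≤ B) :
    Integrable F (ν₀ : Measure X) ∧
      Tendsto (fun k => ∫ x, F x ∂(ν k : Measure X)) atTop (𝓝 (∫ x, F x ∂(ν₀ : Measure X))) := by
  have hB0 : 0 ≤ B := by
    obtain ⟨k, hk⟩ := hB.exists
    exact (integral_nonneg fun x => sq_nonneg _).trans hk.2
  -- truncations `F ∧ M` as bounded continuous functions
  have hmin0 : ∀ (M : ℕ) x, 0 ≤ min (F x) M := fun M x => le_min (hF0 x) M.cast_nonneg
  let FM : ℕ → X →ᵇ ℝ := fun M => BoundedContinuousFunction.ofNormedAddCommGroup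
    (fun x => min (F x) M) (hF.min continuous_const) M (fun x => by
      rw [Real.norm_eq_abs, abs_of_nonneg (hmin0 M x)]
      exact min_le_right _ _)
  have hFM : ∀ M x, FM M x = min (F x) M := fun M x => rfl
  have hwk : ∀ M, Tendsto (fun k => ∫ x, FM M x ∂(ν k : Measure X)) atTop
      (𝓝 (∫ x, FM M x ∂(ν₀ : Measure X))) := fun M =>
    ProbabilityMeasure.tendsto_iff_forall_integral_tendsto.mp hν (FM M)
  -- pointwise inequalities
  have hpt : ∀ M : ℕ, 1 ≤ M → ∀ x, F x - min (F x) M ≤ F x ^ 2 / M := by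
    intro M hM x
    have hMpos : (0 : ℝ) < M := by exact_mod_cast hM
    by_cases h : F x ≤ M
    · rw [min_eq_left h, sub_self]
      positivity
    · push Not at h
      rw [min_eq_right h.le, le_div_iff₀ hMpos]
      nlinarith [hF0 x, h]
  have hpt0 : ∀ (M : ℕ) x, 0 ≤ F x - min (F x) M := fun M x => sub_nonneg.mpr (min_le_left _ _)
  have hF1 : ∀ x, F x ≤ 1 + F x ^ 2 := fun x => by nlinarith [hF0 x]
  -- good indices
  have hgood : ∀ᶠ k in atTop, Integrable F (ν k : Measure X) ∧
      ∫ x, F x ∂(ν k : Measure X) ≤ 1 + B ∧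
      ∀ M : ℕ, 1 ≤ M →
        |∫ x, F x ∂(ν k : Measure X) - ∫ x, FM M x ∂(ν k : Measure X)| ≤ B / M := by
    filter_upwards [hB] with k hk
    obtain ⟨hint2, hle⟩ := hk
    have hintF : Integrable F (ν k : Measure X) :=
      ((integrable_const (1 : ℝ)).add hint2).mono' hF.aestronglyMeasurable
        (Eventually.of_forall fun x => by
          rw [Real.norm_eq_abs, abs_of_nonneg (hF0 x)]
          exact hF1 x)
    refine ⟨hintF, ?_, fun M hM => ?_⟩
    · calc ∫ x, F x ∂(ν k : Measure X) ≤ ∫ x, (1 + F x ^ 2) ∂(ν k : Measure X) :=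
            integral_mono hintF ((integrable_const _).add hint2) hF1
        _ = 1 + ∫ x, F x ^ 2 ∂(ν k : Measure X) := by
            rw [integral_add (integrable_const _) hint2]
            simp
        _ ≤ 1 + B := by linarith
    · have hMpos : (0 : ℝ) < M := by exact_mod_cast hM
      have hintFM : Integrable (FM M) (ν k : Measure X) := (FM M).integrable _
      rw [← integral_sub hintF hintFM,
        abs_of_nonneg (integral_nonneg fun x => hpt0 M x)]
      calc ∫ x, (F x - FM M x) ∂(ν k : Measure X) ≤ ∫ x, F x ^ 2 / M ∂(ν k : Measure X) :=
            integral_mono (hintF.sub hintFM) (hint2.div_const _) fun x => hpt M hM x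
        _ = (∫ x, F x ^ 2 ∂(ν k : Measure X)) / M := integral_div _ _
        _ ≤ B / M := by gcongr
  -- integrability at the limit
  have hFMle : ∀ M : ℕ, ∫ x, FM M x ∂(ν₀ : Measure X) ≤ 1 + B := by
    intro M
    refine le_of_tendsto (hwk M) ?_
    filter_upwards [hgood] with k hk
    calc ∫ x, FM M x ∂(ν k : Measure X) ≤ ∫ x, F x ∂(ν k : Measure X) :=
          integral_mono ((FM M).integrable _) hk.1 fun x => min_le_left _ _
      _ ≤ 1 + B := hk.2.1
  have hint0 : Integrable F (ν₀ : Measure X) := by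
    refine ⟨hF.aestronglyMeasurable, ?_⟩
    rw [hasFiniteIntegral_iff_ofReal (Eventually.of_forall hF0)]
    have hsup : ∀ x, ENNReal.ofReal (F x) = ⨆ M : ℕ, ENNReal.ofReal (min (F x) M) := by
      intro x
      apply le_antisymm
      · obtain ⟨M, hM⟩ := exists_nat_ge (F x)
        exact le_iSup_of_le M (by rw [min_eq_left hM])
      · exact iSup_le fun M => ENNReal.ofReal_le_ofReal (min_le_left _ _)
    have hmeas : ∀ M : ℕ, Measurable fun x => ENNReal.ofReal (min (F x) M) := fun M =>
      (hF.min continuous_const).measurable.ennreal_ofReal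
    have hmono : Monotone fun (M : ℕ) x => ENNReal.ofReal (min (F x) M) :=
      fun M N hMN x => ENNReal.ofReal_le_ofReal (min_le_min_left _ (Nat.cast_le.mpr hMN))
    calc ∫⁻ x, ENNReal.ofReal (F x) ∂(ν₀ : Measure X)
        = ∫⁻ x, ⨆ M : ℕ, ENNReal.ofReal (min (F x) M) ∂(ν₀ : Measure X) :=
          lintegral_congr fun x => hsup x
      _ = ⨆ M : ℕ, ∫⁻ x, ENNReal.ofReal (min (F x) M) ∂(ν₀ : Measure X) :=
          lintegral_iSup hmeas hmono
      _ ≤ ENNReal.ofReal (1 + B) := iSup_le fun M => by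
          have h := ofReal_integral_eq_lintegral_ofReal ((FM M).integrable (ν₀ : Measure X))
            (Eventually.of_forall fun x => hmin0 M x)
          refine le_trans (le_of_eq ?_) (ENNReal.ofReal_le_ofReal (hFMle M))
          exact h.symm
      _ < ⊤ := ENNReal.ofReal_lt_top
  -- dominated convergence at the limit
  have hdc : Tendsto (fun M : ℕ => ∫ x, FM M x ∂(ν₀ : Measure X)) atTop
      (𝓝 (∫ x, F x ∂(ν₀ : Measure X))) := by
    refine tendsto_integral_of_dominated_convergence F
      (fun M => (FM M).continuous.aestronglyMeasurable) hint0
      (fun M => Eventually.of_forall fun x => ?_) (Eventually.of_forall fun x => ?_)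
    · rw [Real.norm_eq_abs, hFM, abs_of_nonneg (hmin0 M x)]
      exact min_le_left _ _
    · refine tendsto_atTop_of_eventually_const (i₀ := ⌈F x⌉₊) fun M hM => ?_
      rw [hFM, min_eq_left ((Nat.le_ceil (F x)).trans (Nat.cast_le.mpr hM))]
  -- conclusion: an `ε/3` argument
  refine ⟨hint0, Metric.tendsto_atTop.mpr fun ε hε => ?_⟩
  obtain ⟨M₁, hM₁⟩ := Metric.tendsto_atTop.mp hdc (ε / 3) (by positivity)
  obtain ⟨M₂, hM₂⟩ := exists_nat_gt (3 * B / ε)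
  obtain ⟨N₂, hN₂⟩ := eventually_atTop.mp hgood
  set M : ℕ := max (max M₁ M₂) 1 with hM_def
  have hM1 : 1 ≤ M := le_max_right _ _
  have hMpos : (0 : ℝ) < M := by exact_mod_cast hM1
  have hBM : B / M < ε / 3 := by
    have h2 : (M₂ : ℝ) ≤ M := by exact_mod_cast (le_max_right M₁ M₂).trans (le_max_left _ 1)
    rw [div_lt_iff₀ hMpos]
    rw [div_lt_iff₀ hε] at hM₂
    nlinarith
  obtain ⟨N₁, hN₁⟩ := Metric.tendsto_atTop.mp (hwk M) (ε / 3) (by positivity)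
  refine ⟨max N₁ N₂, fun k hk => ?_⟩
  have hgk := hN₂ k (le_of_max_le_right hk)
  have hwk' := hN₁ k (le_of_max_le_left hk)
  have h3 := hM₁ M ((le_max_left M₁ M₂).trans (le_max_left _ 1))
  have h1 : dist (∫ x, F x ∂(ν k : Measure X)) (∫ x, FM M x ∂(ν k : Measure X)) < ε / 3 := by
    rw [Real.dist_eq]
    exact (hgk.2.2 M hM1).trans_lt hBM
  calc dist (∫ x, F x ∂(ν k : Measure X)) (∫ x, F x ∂(ν₀ : Measure X))
      ≤ dist (∫ x, F x ∂(ν k : Measure X)) (∫ x, FM M x ∂(ν k : Measure X)) +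
          dist (∫ x, FM M x ∂(ν k : Measure X)) (∫ x, FM M x ∂(ν₀ : Measure X)) +
          dist (∫ x, FM M x ∂(ν₀ : Measure X)) (∫ x, F x ∂(ν₀ : Measure X)) :=
        dist_triangle4 _ _ _ _
    _ < ε / 3 + ε / 3 + ε / 3 := by gcongr
    _ = ε := by ring

/-- **Signed observables.** If `ν_k → ν₀` weakly, `F` is continuous with `|F| ≤ H` and
`∫ H² dν_k ≤ B` eventually, then `F` is `ν₀`-integrable and `∫ F dν_k → ∫ F dν₀`
(apply the truncation lemma to `F⁺` and `F⁻`). [folklore] -/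
theorem tendsto_integral_of_abs_le_of_sq_integral_le {ν : ℕ → ProbabilityMeasure X}
    {ν₀ : ProbabilityMeasure X} (hν : Tendsto ν atTop (𝓝 ν₀)) {F H : X → ℝ} (hF : Continuous F)
    (hFH : ∀ x, |F x| ≤ H x) {B : ℝ}
    (hB : ∀ᶠ k in atTop, Integrable (fun x => H x ^ 2) (ν k : Measure X) ∧
      ∫ x, H x ^ 2 ∂(ν k : Measure X) ≤ B) :
    Integrable F (ν₀ : Measure X) ∧
      Tendsto (fun k => ∫ x, F x ∂(ν k : Measure X)) atTop (𝓝 (∫ x, F x ∂(ν₀ : Measure X))) := by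
  have hH0 : ∀ x, 0 ≤ H x := fun x => (abs_nonneg _).trans (hFH x)
  -- positive and negative parts
  set Fp : X → ℝ := fun x => max (F x) 0 with hFp
  set Fm : X → ℝ := fun x => max (-F x) 0 with hFm
  have hFpc : Continuous Fp := hF.max continuous_const
  have hFmc : Continuous Fm := hF.neg.max continuous_const
  have hFp0 : ∀ x, 0 ≤ Fp x := fun x => le_max_right _ _
  have hFm0 : ∀ x, 0 ≤ Fm x := fun x => le_max_right _ _
  have hFpH : ∀ x, Fp x ≤ H x := fun x => max_le ((le_abs_self _).trans (hFH x)) (hH0 x)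
  have hFmH : ∀ x, Fm x ≤ H x := fun x => max_le ((neg_le_abs _).trans (hFH x)) (hH0 x)
  have hsq : ∀ {P : X → ℝ}, Continuous P → (∀ x, 0 ≤ P x) → (∀ x, P x ≤ H x) →
      ∀ᶠ k in atTop, Integrable (fun x => P x ^ 2) (ν k : Measure X) ∧
        ∫ x, P x ^ 2 ∂(ν k : Measure X) ≤ B := by
    intro P hPc hP0 hPH
    filter_upwards [hB] with k hk
    have hle : ∀ x, P x ^ 2 ≤ H x ^ 2 := fun x => pow_le_pow_left₀ (hP0 x) (hPH x) 2
    have hint : Integrable (fun x => P x ^ 2) (ν k : Measure X) :=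
      hk.1.mono' (hPc.pow 2).aestronglyMeasurable (Eventually.of_forall fun x => by
        rw [Real.norm_eq_abs, abs_of_nonneg (sq_nonneg _)]
        exact hle x)
    exact ⟨hint, (integral_mono hint hk.1 hle).trans hk.2⟩
  obtain ⟨hpi, hpt⟩ := tendsto_integral_of_sq_integral_le hν hFpc hFp0 (hsq hFpc hFp0 hFpH)
  obtain ⟨hmi, hmt⟩ := tendsto_integral_of_sq_integral_le hν hFmc hFm0 (hsq hFmc hFm0 hFmH)
  have hdec : ∀ x, F x = Fp x - Fm x := fun x => (max_zero_sub_max_neg_zero_eq_self (F x)).symm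
  have hFeq : F = fun x => Fp x - Fm x := funext hdec
  -- integrability of the parts along the sequence
  have hparts : ∀ᶠ k in atTop, Integrable Fp (ν k : Measure X) ∧ Integrable Fm (ν k : Measure X) := by
    filter_upwards [hB] with k hk
    have hdom : ∀ {P : X → ℝ}, Continuous P → (∀ x, 0 ≤ P x) → (∀ x, P x ≤ H x) →
        Integrable P (ν k : Measure X) := by
      intro P hPc hP0 hPH
      refine ((integrable_const (1 : ℝ)).add hk.1).mono' hPc.aestronglyMeasurable
        (Eventually.of_forall fun x => ?_)
      rw [Real.norm_eq_abs, abs_of_nonneg (hP0 x)]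
      change P x ≤ 1 + H x ^ 2
      nlinarith [hPH x, hP0 x, sq_nonneg (2 * H x - 1)]
    exact ⟨hdom hFpc hFp0 hFpH, hdom hFmc hFm0 hFmH⟩
  refine ⟨?_, ?_⟩
  · rw [hFeq]; exact hpi.sub hmi
  · have hlim : ∫ x, F x ∂(ν₀ : Measure X) =
        ∫ x, Fp x ∂(ν₀ : Measure X) - ∫ x, Fm x ∂(ν₀ : Measure X) := by
      rw [hFeq]; exact integral_sub hpi hmi
    rw [hlim]
    refine (hpt.sub hmt).congr' ?_
    filter_upwards [hparts] with k hk
    rw [hFeq, integral_sub hk.1 hk.2]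

end WeakLimits

/-! ### Products over the sites of a finite graph -/

section Product

variable {V : Type*} [Fintype V]

/-- Weak convergence of the single-site laws gives weak convergence of the product laws over the
(finitely many) sites (Mathlib: the product of probability measures depends continuously on the
factors). [folklore] -/
theorem tendsto_pi_of_tendsto {ν : ℕ → ProbabilityMeasure ℝ} {ν₀ : ProbabilityMeasure ℝ}
    (hν : Tendsto ν atTop (𝓝 ν₀)) :
    Tendsto (fun k => ProbabilityMeasure.pi fun _ : V => ν k) atTop
      (𝓝 (ProbabilityMeasure.pi fun _ : V => ν₀)) :=
  (ProbabilityMeasure.continuous_pi.tendsto _).comp (tendsto_pi_nhds.mpr fun _ => hν)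

/-- `e^{b ∑ₓ φₓ²} = ∏ₓ e^{b φₓ²}`. [folklore] -/
theorem exp_mul_sum_sq (b : ℝ) (φ : V → ℝ) :
    Real.exp (b * ∑ x, φ x ^ 2) = ∏ x, Real.exp (b * φ x ^ 2) := by
  rw [Finset.mul_sum, Real.exp_sum]

/-- Gaussian-exponential moments of a product law factorise:
`∫ e^{b ∑ₓ φₓ²} d ν^{⊗V} = (∫ e^{b u²} dν)^{|V|}`. [folklore] -/
theorem integral_exp_mul_sum_sq_pi (ν : Measure ℝ) [SigmaFinite ν] (b : ℝ) :
    ∫ φ, Real.exp (b * ∑ x, φ x ^ 2) ∂(Measure.pi fun _ : V => ν) =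
      (∫ u, Real.exp (b * u ^ 2) ∂ν) ^ Fintype.card V := by
  simp_rw [exp_mul_sum_sq]
  exact integral_fintype_prod_eq_pow (ι := V) (fun u => Real.exp (b * u ^ 2))

/-- Integrability of `e^{b ∑ₓ φₓ²}` under a product law from integrability of `e^{b u²}` under the
factor. [folklore] -/
theorem integrable_exp_mul_sum_sq_pi {ν : Measure ℝ} [SigmaFinite ν] {b : ℝ}
    (h : Integrable (fun u => Real.exp (b * u ^ 2)) ν) :
    Integrable (fun φ : V → ℝ => Real.exp (b * ∑ x, φ x ^ 2)) (Measure.pi fun _ : V => ν) := by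
  have h' := Integrable.fintype_prod (ι := V) (f := fun (_ : V) (u : ℝ) => Real.exp (b * u ^ 2))
    (μ := fun _ => ν) fun _ => h
  exact h'.congr (Eventually.of_forall fun φ => (exp_mul_sum_sq b φ).symm)

/-- **Observables of Gaussian-exponential growth pass to the limit of product laws.** If
`ν_k → ν₀` weakly on `ℝ` with the Gaussian-exponential moments `∫ e^{b u²} dν_k` bounded in `k`
for every `b` (the moment clause of `IsIsingLimitLaw`), then for every continuous
`F : (V → ℝ) → ℝ` with `|F(φ)| ≤ C e^{b ∑ₓ φₓ²}`, `F` is `ν₀^{⊗V}`-integrable and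
`∫ F dν_k^{⊗V} → ∫ F dν₀^{⊗V}`. (Simon–Griffiths 1973, §II–III: this is how the single-site
approximation is used; Aizenman–Duminil-Copin 2021, §2, p. 7.) [cite: AizenmanDuminilCopinAnnals2021, §2 (p. 7)] -/
theorem tendsto_integral_pi_of_tendsto {ν : ℕ → ProbabilityMeasure ℝ} {ν₀ : ProbabilityMeasure ℝ}
    (hν : Tendsto ν atTop (𝓝 ν₀))
    (hmom : ∀ b : ℝ, ∃ C : ℝ, ∀ k, Integrable (fun u => Real.exp (b * u ^ 2)) (ν k : Measure ℝ) ∧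
      ∫ u, Real.exp (b * u ^ 2) ∂(ν k : Measure ℝ) ≤ C)
    {F : (V → ℝ) → ℝ} (hF : Continuous F) {C b : ℝ}
    (hFb : ∀ φ, |F φ| ≤ C * Real.exp (b * ∑ x, φ x ^ 2)) :
    Integrable F (Measure.pi fun _ : V => (ν₀ : Measure ℝ)) ∧
      Tendsto (fun k => ∫ φ, F φ ∂(Measure.pi fun _ : V => (ν k : Measure ℝ))) atTop
        (𝓝 (∫ φ, F φ ∂(Measure.pi fun _ : V => (ν₀ : Measure ℝ)))) := by
  have hC : 0 ≤ C := by
    have h := hFb 0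
    simp only [Pi.zero_apply, ne_eq, OfNat.ofNat_ne_zero, not_false_eq_true, zero_pow,
      Finset.sum_const_zero, mul_zero, Real.exp_zero, mul_one] at h
    exact (abs_nonneg _).trans h
  obtain ⟨C₂, hC₂⟩ := hmom (2 * b)
  set H : (V → ℝ) → ℝ := fun φ => C * Real.exp (b * ∑ x, φ x ^ 2) with hH_def
  have hH2 : ∀ φ : V → ℝ, H φ ^ 2 = C ^ 2 * Real.exp ((2 * b) * ∑ x, φ x ^ 2) := fun φ => by
    rw [hH_def, mul_pow, sq (Real.exp _), ← Real.exp_add]; ring_nf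
  have hB : ∀ᶠ k in atTop,
      Integrable (fun φ => H φ ^ 2) ((ProbabilityMeasure.pi fun _ : V => ν k : ProbabilityMeasure
        (V → ℝ)) : Measure (V → ℝ)) ∧
      ∫ φ, H φ ^ 2 ∂((ProbabilityMeasure.pi fun _ : V => ν k : ProbabilityMeasure (V → ℝ)) :
        Measure (V → ℝ)) ≤ C ^ 2 * C₂ ^ Fintype.card V := by
    refine Eventually.of_forall fun k => ?_
    rw [ProbabilityMeasure.toMeasure_pi]
    simp_rw [hH2]
    refine ⟨(integrable_exp_mul_sum_sq_pi (hC₂ k).1).const_mul _, ?_⟩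
    rw [integral_const_mul, integral_exp_mul_sum_sq_pi]
    refine mul_le_mul_of_nonneg_left (pow_le_pow_left₀ (integral_nonneg fun u =>
      (Real.exp_pos _).le) (hC₂ k).2 _) (sq_nonneg _)
  have key := tendsto_integral_of_abs_le_of_sq_integral_le (tendsto_pi_of_tendsto (V := V) hν)
    hF hFb hB
  simpa only [ProbabilityMeasure.toMeasure_pi] using key

end Product

/-! ### Tilting the product law by the nearest-neighbour coupling: `latticeFieldMeasure` -/

section Tilt

variable {V : Type*} [Fintype V] (G : SimpleGraph V) [DecidableRel G.Adj]

/-- The pair interaction `∑_{xy ∈ E(G)} φₓ φ_y` is continuous (a polynomial). [folklore] -/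
@[fun_prop]
theorem continuous_pairInteraction : Continuous (pairInteraction G) := by
  unfold pairInteraction
  refine continuous_finsetSum _ fun e _ => ?_
  induction e using Sym2.ind with
  | h x y => simp only [Sym2.lift_mk]; fun_prop

/-- Gaussian domination of the coupling weight: `e^{J ∑_{xy} φₓφ_y} ≤ e^{|J| #E(G) ∑ₓ φₓ²}`
(`abs_pairInteraction_le`). [folklore] -/
theorem exp_mul_pairInteraction_le (J : ℝ) (φ : V → ℝ) :
    Real.exp (J * pairInteraction G φ) ≤
      Real.exp (|J| * G.edgeFinset.card * ∑ x, φ x ^ 2) := by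
  refine Real.exp_le_exp.mpr ?_
  calc J * pairInteraction G φ ≤ |J * pairInteraction G φ| := le_abs_self _
    _ = |J| * |pairInteraction G φ| := abs_mul _ _
    _ ≤ |J| * ((G.edgeFinset.card : ℝ) * ∑ x, φ x ^ 2) :=
        mul_le_mul_of_nonneg_left (abs_pairInteraction_le G φ) (abs_nonneg _)
    _ = |J| * G.edgeFinset.card * ∑ x, φ x ^ 2 := by ring

/-- Expectations under `latticeFieldMeasure G ν J = Z⁻¹ e^{J ∑_{xy} φₓφ_y} ν^{⊗V}` are ratios
`∫ F e^{J∑φφ} dν^{⊗V} / ∫ e^{J∑φφ} dν^{⊗V}` (Mathlib `integral_tilted`; both sides are `0` when the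
tilt is not integrable). (Griffiths–Simon 1973; Aizenman–Duminil-Copin 2021, §1.2, p. 4, the Gibbs-state display.) [cite: AizenmanDuminilCopinAnnals2021, §1.2 (p. 4)] -/
theorem integral_latticeFieldMeasure (ν : Measure ℝ) (J : ℝ) (F : (V → ℝ) → ℝ) :
    ∫ φ, F φ ∂(latticeFieldMeasure G ν J) =
      (∫ φ, F φ * Real.exp (J * pairInteraction G φ) ∂(Measure.pi fun _ : V => ν)) /
        ∫ φ, Real.exp (J * pairInteraction G φ) ∂(Measure.pi fun _ : V => ν) := by
  rw [latticeFieldMeasure, integral_tilted]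
  simp_rw [smul_eq_mul]
  rw [← integral_div]
  refine integral_congr_ae (Eventually.of_forall fun φ => ?_)
  simp only
  ring

/-- For a single-site probability law with the Gaussian-exponential moment
`∫ e^{|J| #E(G) u²} dν < ∞`, `latticeFieldMeasure G ν J` is a probability measure (the tilt
`e^{J ∑ φₓφ_y} ≤ ∏ₓ e^{|J| #E φₓ²}` is `ν^{⊗V}`-integrable). [folklore] -/
theorem isProbabilityMeasure_latticeFieldMeasure (ν : Measure ℝ) [IsProbabilityMeasure ν] (J : ℝ)
    (hν : Integrable (fun u => Real.exp (|J| * G.edgeFinset.card * u ^ 2)) ν) :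
    IsProbabilityMeasure (latticeFieldMeasure G ν J) := by
  unfold latticeFieldMeasure
  refine isProbabilityMeasure_tilted ?_
  refine (integrable_exp_mul_sum_sq_pi (V := V) hν).mono' (by fun_prop)
    (Eventually.of_forall fun φ => ?_)
  rw [Real.norm_of_nonneg (Real.exp_pos _).le]
  exact exp_mul_pairInteraction_le G J φ

/-- **The Griffiths–Simon transfer for the coupled system (finite graph).** If single-site
probability laws `ν_k → ν₀` converge weakly on `ℝ` with `sup_k ∫ e^{b u²} dν_k < ∞` for every `b`
(as for Ising limit laws, `IsIsingLimitLaw`), then for every real coupling `J` and every continuous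
observable `F` of Gaussian-exponential growth, `|F(φ)| ≤ C e^{b ∑ₓ φₓ²}`,
`∫ F d(latticeFieldMeasure G ν_k J) → ∫ F d(latticeFieldMeasure G ν₀ J)`:
numerator and denominator of `integral_latticeFieldMeasure` converge by
`tendsto_integral_pi_of_tendsto` (the coupling weight is Gaussian-dominated,
`exp_mul_pairInteraction_le`) and the limiting partition function is positive. This is the step
"any system of `φ⁴` variables associated with the sites of a graph, and coupled through the
graph's edges, is presentable as the limit (`N → ∞`) of a system of constituent Ising spins"
(Aizenman–Duminil-Copin 2021, §2, p. 7, after Simon–Griffiths 1973) in the tree's vocabulary,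
for general single-site approximants. [cite: AizenmanDuminilCopinAnnals2021, §2 (p. 7, last paragraph)] -/
theorem tendsto_integral_latticeFieldMeasure {ν : ℕ → ProbabilityMeasure ℝ}
    {ν₀ : ProbabilityMeasure ℝ} (hν : Tendsto ν atTop (𝓝 ν₀))
    (hmom : ∀ b : ℝ, ∃ C : ℝ, ∀ k, Integrable (fun u => Real.exp (b * u ^ 2)) (ν k : Measure ℝ) ∧
      ∫ u, Real.exp (b * u ^ 2) ∂(ν k : Measure ℝ) ≤ C)
    (J : ℝ) {F : (V → ℝ) → ℝ} (hF : Continuous F) {C b : ℝ}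
    (hFb : ∀ φ, |F φ| ≤ C * Real.exp (b * ∑ x, φ x ^ 2)) :
    Tendsto (fun k => ∫ φ, F φ ∂(latticeFieldMeasure G (ν k : Measure ℝ) J)) atTop
      (𝓝 (∫ φ, F φ ∂(latticeFieldMeasure G (ν₀ : Measure ℝ) J))) := by
  set B : ℝ := |J| * G.edgeFinset.card with hB_def
  have hC : 0 ≤ C := by
    have h := hFb 0
    simp only [Pi.zero_apply, ne_eq, OfNat.ofNat_ne_zero, not_false_eq_true, zero_pow,
      Finset.sum_const_zero, mul_zero, Real.exp_zero, mul_one] at h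
    exact (abs_nonneg _).trans h
  -- numerator
  have hnum := tendsto_integral_pi_of_tendsto (V := V) hν hmom
    (F := fun φ => F φ * Real.exp (J * pairInteraction G φ)) (hF.mul (by fun_prop))
    (C := C) (b := b + B) (fun φ => by
      rw [abs_mul, abs_of_pos (Real.exp_pos _)]
      calc |F φ| * Real.exp (J * pairInteraction G φ)
          ≤ C * Real.exp (b * ∑ x, φ x ^ 2) * Real.exp (B * ∑ x, φ x ^ 2) :=
            mul_le_mul (hFb φ) (exp_mul_pairInteraction_le G J φ) (Real.exp_pos _).le
              (mul_nonneg hC (Real.exp_pos _).le)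
        _ = C * Real.exp ((b + B) * ∑ x, φ x ^ 2) := by
            rw [mul_assoc, ← Real.exp_add]
            congr 2
            ring)
  -- denominator
  have hden := tendsto_integral_pi_of_tendsto (V := V) hν hmom
    (F := fun φ => Real.exp (J * pairInteraction G φ)) (by fun_prop)
    (C := 1) (b := B) (fun φ => by
      rw [abs_of_pos (Real.exp_pos _), one_mul]
      exact exp_mul_pairInteraction_le G J φ)
  have hZ₀ : (∫ φ, Real.exp (J * pairInteraction G φ) ∂(Measure.pi fun _ : V => (ν₀ : Measure ℝ)))
      ≠ 0 := (integral_exp_pos hden.1).ne'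
  simp_rw [integral_latticeFieldMeasure]
  exact hnum.2.div hden.2 hZ₀

end Tilt

/-! ### Identification: the lattice `φ⁴` measure is a tilted product law -/

section Identification

/-- Tonelli for finite products of measures (dependent version), from the tree's `Fin n` case
`Literature.Probability.Distributions.lintegral_fin_nat_prod_eq_prod`; the same six lines as
`Literature.MathematicalPhysics.QuantumFieldTheory.lintegral_fintype_prod_eq_prod_dep`
(`GaussianToolkit`, whose blanket `import Mathlib` is not wanted here). [folklore] -/
private theorem lintegral_fintype_prod_eq_prod_dep {ι : Type*} [Fintype ι] {E : ι → Type*}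
    [∀ i, MeasurableSpace (E i)] (μ : ∀ i, Measure (E i)) [∀ i, SigmaFinite (μ i)]
    {f : ∀ i, E i → ℝ≥0∞} (hf : ∀ i, Measurable (f i)) :
    ∫⁻ x, ∏ i, f i (x i) ∂(Measure.pi μ) = ∏ i, ∫⁻ x, f i x ∂(μ i) := by
  let e := (Fintype.equivFin ι).symm
  rw [← (measurePreserving_piCongrLeft _ e).lintegral_comp_emb
    (MeasurableEquiv.measurableEmbedding _)]
  simp_rw [← e.prod_comp, MeasurableEquiv.coe_piCongrLeft, Equiv.piCongrLeft_apply_apply,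
    Literature.Probability.Distributions.lintegral_fin_nat_prod_eq_prod _ _ (fun i => hf _)]

/-- `⊗ᵢ (fᵢ μᵢ) = (∏ᵢ fᵢ(xᵢ)) ⊗ᵢ μᵢ` (as in `GaussianToolkit.pi_withDensity`). [folklore] -/
private theorem pi_withDensity {ι : Type*} [Fintype ι] {E : Type*} [MeasurableSpace E]
    (μ : ι → Measure E) [∀ i, SigmaFinite (μ i)] (f : ι → E → ℝ≥0∞) (hf : ∀ i, Measurable (f i))
    [∀ i, SigmaFinite ((μ i).withDensity (f i))] :
    Measure.pi (fun i => (μ i).withDensity (f i)) =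
      (Measure.pi μ).withDensity fun x => ∏ i, f i (x i) := by
  refine Measure.pi_eq fun s hs => ?_
  rw [withDensity_apply _ (MeasurableSet.univ_pi hs), Measure.restrict_pi_pi,
    lintegral_fintype_prod_eq_prod_dep _ hf]
  exact Finset.prod_congr rfl fun i _ => (withDensity_apply _ (hs i)).symm

/-- **A tilted measure is the normalised density measure**: for `μ ≠ 0` and `e^{f}` `μ`-integrable,
`μ.tilted f = (∫⁻ e^{f} dμ)⁻¹ • (e^{f} μ)`. This is the shape in which the tree's
`isIsingLimitLaw_phi4` writes the normalised single-site `φ⁴` law. [folklore] -/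
theorem tilted_eq_smul_withDensity {α : Type*} [MeasurableSpace α] (μ : Measure α) [NeZero μ]
    {f : α → ℝ} (hf : Integrable (fun x => Real.exp (f x)) μ) :
    μ.tilted f = (∫⁻ x, ENNReal.ofReal (Real.exp (f x)) ∂μ)⁻¹ •
      μ.withDensity fun x => ENNReal.ofReal (Real.exp (f x)) := by
  have hZ : 0 < ∫ x, Real.exp (f x) ∂μ := integral_exp_pos hf
  have hL : ∫⁻ x, ENNReal.ofReal (Real.exp (f x)) ∂μ = ENNReal.ofReal (∫ x, Real.exp (f x) ∂μ) :=
    (ofReal_integral_eq_lintegral_ofReal hf (Eventually.of_forall fun _ => (Real.exp_pos _).le)).symm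
  ext s hs
  rw [tilted_apply' _ _ hs, Measure.smul_apply, withDensity_apply _ hs, smul_eq_mul, hL]
  have hpt : ∀ x, ENNReal.ofReal (Real.exp (f x) / ∫ x, Real.exp (f x) ∂μ) =
      ENNReal.ofReal (Real.exp (f x)) * (ENNReal.ofReal (∫ x, Real.exp (f x) ∂μ))⁻¹ := fun x => by
    rw [div_eq_mul_inv, ENNReal.ofReal_mul (Real.exp_pos _).le, ENNReal.ofReal_inv_of_pos hZ]
  simp_rw [hpt]
  rw [lintegral_mul_const'' _ (hf.1.aemeasurable.ennreal_ofReal.restrict), mul_comm]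

variable {V : Type*} [Fintype V]

/-- **Products of tilted laws are tilted products**: `⊗ₓ (μ tilted by h) = μ^{⊗V}` tilted by
`φ ↦ ∑ₓ h(φₓ)` (the normalisations multiply: `∫ e^{∑ h(φₓ)} dμ^{⊗V} = (∫ e^{h} dμ)^{|V|}`).
[folklore] -/
theorem pi_tilted (μ : Measure ℝ) [SigmaFinite μ] {h : ℝ → ℝ} (hh : Measurable h) :
    (Measure.pi fun _ : V => μ.tilted h) =
      (Measure.pi fun _ : V => μ).tilted fun φ => ∑ x, h (φ x) := by
  have hZ : ∫ φ, Real.exp (∑ x, h (φ x)) ∂(Measure.pi fun _ : V => μ) =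
      (∫ u, Real.exp (h u) ∂μ) ^ Fintype.card V := by
    simp_rw [Real.exp_sum]
    exact integral_fintype_prod_eq_pow (ι := V) (fun u => Real.exp (h u))
  unfold Measure.tilted
  rw [pi_withDensity (fun _ : V => μ)
    (fun _ u => ENNReal.ofReal (Real.exp (h u) / ∫ x, Real.exp (h x) ∂μ))
    (fun _ => ((Real.measurable_exp.comp hh).div_const _).ennreal_ofReal)]
  congr 1
  funext φ
  rw [hZ, ← ENNReal.ofReal_prod_of_nonneg (fun _ _ => by positivity), Finset.prod_div_distrib,
    ← Real.exp_sum, Finset.prod_const, Finset.card_univ]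

variable (G : SimpleGraph V) [DecidableRel G.Adj]

/-- With single-site law `Z₁⁻¹ e^{h(u)} du`, the coupled lattice measure is Lebesgue measure on
`V → ℝ` tilted by `∑ₓ h(φₓ) + J ∑_{xy} φₓφ_y` (Mathlib `tilted_tilted`). [folklore] -/
theorem latticeFieldMeasure_tilted_volume {h : ℝ → ℝ} (hh : Measurable h)
    (hint : Integrable (fun u => Real.exp (h u))) (J : ℝ) :
    latticeFieldMeasure G ((volume : Measure ℝ).tilted h) J =
      (volume : Measure (V → ℝ)).tilted fun φ => (∑ x, h (φ x)) + J * pairInteraction G φ := by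
  have hI : Integrable (fun φ : V → ℝ => Real.exp (∑ x, h (φ x)))
      (Measure.pi fun _ : V => (volume : Measure ℝ)) := by
    have hp := Integrable.fintype_prod (ι := V) (f := fun (_ : V) (u : ℝ) => Real.exp (h u))
      (μ := fun _ => (volume : Measure ℝ)) fun _ => hint
    exact hp.congr (Eventually.of_forall fun φ => (Real.exp_sum _ _).symm)
  unfold latticeFieldMeasure
  rw [pi_tilted volume hh, tilted_tilted hI, volume_pi]
  rfl

/-- **The lattice `φ⁴` measure is a Griffiths–Simon lattice measure**: for `g > 0`,
`phi4Measure G g κ J = latticeFieldMeasure G ν_{g,κ} J` with the normalised single-site law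
`ν_{g,κ} = Z₁⁻¹ e^{−g u⁴ − κ u²} du` (the law of `isIsingLimitLaw_phi4`), written as
`volume.tilted (u ↦ −g u⁴ − κ u²)`. (Aizenman–Duminil-Copin 2021, §1.2, p. 4: Gibbs states with a-priori
measure `ρ(dφ) = e^{-λφ⁴+bφ²} dφ`; Simon–Griffiths 1973.) [cite: AizenmanDuminilCopinAnnals2021, §1.2 (p. 4)] -/
theorem latticeFieldMeasure_phi4SiteLaw {g : ℝ} (hg : 0 < g) (κ J : ℝ) :
    latticeFieldMeasure G ((volume : Measure ℝ).tilted fun u => -g * u ^ 4 - κ * u ^ 2) J =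
      phi4Measure G g κ J := by
  rw [latticeFieldMeasure_tilted_volume G (by fun_prop)
    (Literature.Probability.LatticeModels.SimonGriffiths.integrable_phi4Density hg κ) J, phi4Measure]
  congr 1
  funext φ
  simp only [phi4Action, Finset.sum_add_distrib]
  have : ∑ x, (-g * φ x ^ 4 - κ * φ x ^ 2) = -(∑ x, g * φ x ^ 4 + ∑ x, κ * φ x ^ 2) := by
    rw [← Finset.sum_add_distrib, ← Finset.sum_neg_distrib]
    exact Finset.sum_congr rfl fun x _ => by ring
  rw [this]
  ring

/-- The normalised single-site `φ⁴` law is a probability measure (`g > 0`). [folklore] -/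
theorem isProbabilityMeasure_phi4SiteLaw {g : ℝ} (hg : 0 < g) (κ : ℝ) :
    IsProbabilityMeasure ((volume : Measure ℝ).tilted fun u => -g * u ^ 4 - κ * u ^ 2) :=
  isProbabilityMeasure_tilted
    (Literature.Probability.LatticeModels.SimonGriffiths.integrable_phi4Density hg κ)

end Identification

/-! ### Block Ising approximants of the lattice `φ⁴` measure -/

section BlockIsing

open Literature.Probability.LatticeModels

variable {V : Type*} [Fintype V] (G : SimpleGraph V) [DecidableRel G.Adj]

/-- Everything is integrable against a finite magnetization law (a finite mixture of Dirac
masses); cf. `integrable_isingMagnetizationLaw` of `IsingLimitLawLaplace`, not imported here.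
[folklore] -/
private theorem integrable_magnetizationLaw {n : ℕ} (K : Fin n → Fin n → ℝ) (w : Fin n → ℝ)
    {f : ℝ → ℝ} (hf : StronglyMeasurable f) :
    Integrable f (isingMagnetizationLaw n K w : Measure ℝ) := by
  have hmeas := measurable_of_config (weightedMagnetization w)
  change Integrable f ((isingPairPMF K).map (weightedMagnetization w)).toMeasure
  rw [← PMF.toMeasure_map (weightedMagnetization w) (isingPairPMF K) hmeas,
    integrable_map_measure hf.aestronglyMeasurable hmeas.aemeasurable]
  exact Integrable.of_finite

/-- **Block Ising approximation of the lattice `φ⁴` measure on a finite graph**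
(Simon–Griffiths 1973; Aizenman–Duminil-Copin 2021, §2, p. 7: "any system of `φ⁴` variables
associated with the sites of a graph `𝒱`, and coupled through the graph's edges, is presentable
as the limit (`N → ∞`) of a system of constituent Ising spins associated with the Cartesian graph
product `ℤᵈ × 𝒦_N`"). For `g > 0` and all real `κ`, `J` there are ferromagnetic finite Ising
systems — `n_k` elemental spins per site with pair couplings `K_k ≥ 0` and block weights `w_k ≥ 0`,
those of `isIsingLimitLaw_phi4_holds` (Simon–Griffiths' Curie–Weiss blocks) — such that the coupled
lattice laws of the block variables `τₓ = ∑ᵢ w_{k,i} σ_{x,i}`,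
`latticeFieldMeasure G (isingMagnetizationLaw n_k K_k w_k) J`, converge to `phi4Measure G g κ J` on
every continuous observable of Gaussian-exponential growth (in particular on all polynomials and
all exponentials of the fields): `tendsto_integral_latticeFieldMeasure` with
`latticeFieldMeasure_phi4SiteLaw`. The Gibbs-sum form of the approximants, an Ising model on
`V × Fin n_k`, is `integral_latticeFieldMeasure_isingMagnetizationLaw`. [cite: AizenmanDuminilCopinAnnals2021, §2 (p. 7, last paragraph); SimonGriffiths1973, §2 Thm. 1] -/
theorem exists_blockIsing_tendsto_integral_phi4Measure {g : ℝ} (hg : 0 < g) (κ J : ℝ) :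
    ∃ (n : ℕ → ℕ) (K : ∀ k, Fin (n k) → Fin (n k) → ℝ) (w : ∀ k, Fin (n k) → ℝ),
      (∀ k i j, 0 ≤ K k i j) ∧ (∀ k i, 0 ≤ w k i) ∧
      ∀ (F : (V → ℝ) → ℝ), Continuous F → ∀ C b : ℝ,
        (∀ φ, |F φ| ≤ C * Real.exp (b * ∑ x, φ x ^ 2)) →
        Tendsto (fun k => ∫ φ, F φ ∂(latticeFieldMeasure G
            (isingMagnetizationLaw (n k) (K k) (w k) : Measure ℝ) J)) atTop
          (𝓝 (∫ φ, F φ ∂(phi4Measure G g κ J))) := by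
  have hint : Integrable (fun u : ℝ => Real.exp (-g * u ^ 4 - κ * u ^ 2)) :=
    SimonGriffiths.integrable_phi4Density hg κ
  haveI := isProbabilityMeasure_phi4SiteLaw hg κ
  set ν₀ : ProbabilityMeasure ℝ :=
    ⟨(volume : Measure ℝ).tilted fun u => -g * u ^ 4 - κ * u ^ 2, this⟩ with hν₀_def
  have hν₀ : (ν₀ : Measure ℝ) = (∫⁻ u, ENNReal.ofReal (Real.exp (-g * u ^ 4 - κ * u ^ 2)))⁻¹ •
      volume.withDensity (fun u => ENNReal.ofReal (Real.exp (-g * u ^ 4 - κ * u ^ 2))) :=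
    tilted_eq_smul_withDensity volume hint
  obtain ⟨n, K, w, hK, hw, hlim, hmom⟩ := isIsingLimitLaw_phi4_holds g κ hg ν₀ hν₀
  refine ⟨n, K, w, hK, hw, fun F hF C b hFb => ?_⟩
  have hmom' : ∀ b : ℝ, ∃ C : ℝ, ∀ k, Integrable (fun u => Real.exp (b * u ^ 2))
      (isingMagnetizationLaw (n k) (K k) (w k) : Measure ℝ) ∧
      ∫ u, Real.exp (b * u ^ 2) ∂(isingMagnetizationLaw (n k) (K k) (w k) : Measure ℝ) ≤ C := by
    intro b'
    obtain ⟨C', hC'⟩ := hmom b'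
    exact ⟨C', fun k => ⟨integrable_magnetizationLaw _ _
      (by fun_prop : Continuous fun u : ℝ => Real.exp (b' * u ^ 2)).stronglyMeasurable, hC' k⟩⟩
  have h := tendsto_integral_latticeFieldMeasure G hlim hmom' J hF hFb
  rwa [show latticeFieldMeasure G (ν₀ : Measure ℝ) J = phi4Measure G g κ J from
    latticeFieldMeasure_phi4SiteLaw G hg κ J] at h

variable [DecidableEq V]

/-- **Product laws of block magnetizations are finite Gibbs sums**: for a measurable observable,
`∫ H d(law_{K,w})^{⊗V} = ∑_{s : V → {±1}^n} (∏ₓ B_K(sₓ)/Z_K) H(τ(s))`, `τ(s)ₓ = ∑ᵢ wᵢ s_{x,i}`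
(`Measure.pi_map_pi`, `Measure.pi_singleton`, `integral_fintype`). [folklore] -/
theorem integral_pi_isingMagnetizationLaw {n : ℕ} (K : Fin n → Fin n → ℝ) (w : Fin n → ℝ)
    {H : (V → ℝ) → ℝ} (hH : Measurable H) :
    ∫ φ, H φ ∂(Measure.pi fun _ : V => (isingMagnetizationLaw n K w : Measure ℝ)) =
      ∑ s : V → Fin n → Bool, (∏ x, isingBoltzmann K (s x) / isingPairPartition K) *
        H (fun x => weightedMagnetization w (s x)) := by
  have hm := measurable_of_config (weightedMagnetization w)
  have hlaw : (isingMagnetizationLaw n K w : Measure ℝ) =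
      ((isingPairPMF K).toMeasure).map (weightedMagnetization w) := by
    change ((isingPairPMF K).map (weightedMagnetization w)).toMeasure = _
    rw [PMF.toMeasure_map _ _ hm]
  have hM : Measurable fun (s : V → Fin n → Bool) (x : V) => weightedMagnetization w (s x) :=
    measurable_of_countable _
  rw [hlaw, ← Measure.pi_map_pi (fun _ => hm.aemeasurable), integral_map hM.aemeasurable
    hH.stronglyMeasurable.aestronglyMeasurable, integral_fintype (Integrable.of_finite)]
  refine Finset.sum_congr rfl fun s _ => ?_
  rw [smul_eq_mul, measureReal_def, Measure.pi_singleton, ENNReal.toReal_prod]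
  congr 1
  refine Finset.prod_congr rfl fun x _ => ?_
  rw [PMF.toMeasure_apply_singleton _ _ (MeasurableSet.singleton _), isingPairPMF,
    PMF.ofFintype_apply, ENNReal.toReal_ofReal
      (div_nonneg (isingBoltzmann_pos K (s x)).le (isingPairPartition_pos K).le)]

/-- **The approximants are ferromagnetic Ising models on `V × Fin n`** (Gibbs-sum form): for a
measurable observable `F`,
`∫ F d(latticeFieldMeasure G law_{K,w} J) = ∑_s F(τ(s)) e^{−ℋ(s)} / ∑_s e^{−ℋ(s)}`, the sums over
`s : V → Fin n → Bool` (an Ising configuration on `V × Fin n`), with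
`−ℋ(s) = ∑ₓ ∑ᵢⱼ Kᵢⱼ s_{x,i}s_{x,j} + J ∑_{xy ∈ E(G)} τₓ(s) τ_y(s)`, `τₓ(s) = ∑ᵢ wᵢ s_{x,i}`: intra-block
pair couplings `K` and inter-block couplings `J wᵢ wⱼ` along the edges of `G` — all `≥ 0` when
`K ≥ 0`, `w ≥ 0`, `J ≥ 0` (Aizenman–Duminil-Copin 2021, Def. 2.1 (1) and the block-spin displays after it, p. 7). [cite: AizenmanDuminilCopinAnnals2021, §2 Def. 2.1 (1) and the paragraph after it (p. 7)] -/
theorem integral_latticeFieldMeasure_isingMagnetizationLaw {n : ℕ} (K : Fin n → Fin n → ℝ)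
    (w : Fin n → ℝ) (J : ℝ) {F : (V → ℝ) → ℝ} (hF : Measurable F) :
    ∫ φ, F φ ∂(latticeFieldMeasure G (isingMagnetizationLaw n K w : Measure ℝ) J) =
      (∑ s : V → Fin n → Bool, F (fun x => weightedMagnetization w (s x)) *
          Real.exp (∑ x, isingPairEnergy K (s x) +
            J * pairInteraction G (fun x => weightedMagnetization w (s x)))) /
        ∑ s : V → Fin n → Bool, Real.exp (∑ x, isingPairEnergy K (s x) +
            J * pairInteraction G (fun x => weightedMagnetization w (s x))) := by
  have hmF : Measurable fun φ : V → ℝ => F φ * Real.exp (J * pairInteraction G φ) :=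
    hF.mul (by fun_prop)
  have hm1 : Measurable fun φ : V → ℝ => Real.exp (J * pairInteraction G φ) := by fun_prop
  rw [integral_latticeFieldMeasure, integral_pi_isingMagnetizationLaw K w hmF,
    integral_pi_isingMagnetizationLaw K w hm1]
  have hZ : (0 : ℝ) < isingPairPartition K ^ Fintype.card V :=
    pow_pos (isingPairPartition_pos K) _
  have hprod : ∀ s : V → Fin n → Bool, ∏ x, isingBoltzmann K (s x) / isingPairPartition K =
      Real.exp (∑ x, isingPairEnergy K (s x)) / isingPairPartition K ^ Fintype.card V := fun s => by
    rw [Finset.prod_div_distrib, Finset.prod_const, Finset.card_univ, Real.exp_sum]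
    rfl
  simp_rw [hprod]
  have hnum : ∀ (Φ : (V → Fin n → Bool) → ℝ),
      ∑ s : V → Fin n → Bool, Real.exp (∑ x, isingPairEnergy K (s x)) /
          isingPairPartition K ^ Fintype.card V *
        (Φ s * Real.exp (J * pairInteraction G (fun x => weightedMagnetization w (s x)))) =
      (∑ s : V → Fin n → Bool, Φ s * Real.exp (∑ x, isingPairEnergy K (s x) +
          J * pairInteraction G (fun x => weightedMagnetization w (s x)))) /
        isingPairPartition K ^ Fintype.card V := fun Φ => by
    rw [Finset.sum_div]
    refine Finset.sum_congr rfl fun s _ => ?_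
    rw [Real.exp_add]
    ring
  have hden := hnum (fun _ => 1)
  simp only [one_mul] at hden
  rw [hnum, hden, div_div_div_cancel_right₀ hZ.ne']


omit [DecidableEq V] in
/-- **Transfer of inequalities that are linear in the expectation** (the use made of the
approximation in Aizenman–Duminil-Copin 2021, §7, p. 28: bounds available for the Ising model
"extend to the GS class essentially by linearity, and then … by continuity"): if
`⟨F₁⟩ ≤ ⟨F₂⟩` holds under every block-Ising lattice law `latticeFieldMeasure G law_{K,w} J` with
`K ≥ 0`, `w ≥ 0`, for two continuous observables of Gaussian-exponential growth, then
`⟨F₁⟩ ≤ ⟨F₂⟩` under `phi4Measure G g κ J` (`g > 0`). Nonlinear continuous combinations of finitely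
many expectations transfer in the same way from `exists_blockIsing_tendsto_integral_phi4Measure`.
[cite: AizenmanDuminilCopinAnnals2021, §7 (p. 28, first paragraph) and §2 (p. 7)] -/
theorem integral_phi4Measure_le_of_blockIsing {g : ℝ} (hg : 0 < g) (κ J : ℝ)
    {F₁ F₂ : (V → ℝ) → ℝ} (hF₁ : Continuous F₁) (hF₂ : Continuous F₂) {C₁ b₁ C₂ b₂ : ℝ}
    (hb₁ : ∀ φ, |F₁ φ| ≤ C₁ * Real.exp (b₁ * ∑ x, φ x ^ 2))
    (hb₂ : ∀ φ, |F₂ φ| ≤ C₂ * Real.exp (b₂ * ∑ x, φ x ^ 2))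
    (h : ∀ (n : ℕ) (K : Fin n → Fin n → ℝ) (w : Fin n → ℝ), (∀ i j, 0 ≤ K i j) → (∀ i, 0 ≤ w i) →
      ∫ φ, F₁ φ ∂(latticeFieldMeasure G (isingMagnetizationLaw n K w : Measure ℝ) J) ≤
        ∫ φ, F₂ φ ∂(latticeFieldMeasure G (isingMagnetizationLaw n K w : Measure ℝ) J)) :
    ∫ φ, F₁ φ ∂(phi4Measure G g κ J) ≤ ∫ φ, F₂ φ ∂(phi4Measure G g κ J) := by
  obtain ⟨n, K, w, hK, hw, hlim⟩ := exists_blockIsing_tendsto_integral_phi4Measure G hg κ J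
  exact le_of_tendsto_of_tendsto (hlim F₁ hF₁ C₁ b₁ hb₁) (hlim F₂ hF₂ C₂ b₂ hb₂)
    (Eventually.of_forall fun k => h (n k) (K k) (w k) (hK k) (hw k))

omit [Fintype V] [DecidableRel G.Adj] [DecidableEq V] in
/-- **The inter-block couplings.** Along an edge `{x, y}` the coupling `J τₓ τ_y` of the block
variables is the ferromagnetic Ising pair interaction `∑ᵢⱼ (J wᵢ wⱼ) s_{x,i} s_{y,j}` between the
constituent spins of the two blocks (couplings `J wᵢ wⱼ ≥ 0` for `J ≥ 0`, `w ≥ 0`): with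
`integral_latticeFieldMeasure_isingMagnetizationLaw`, the approximants are n.n.f. Ising models on
`V × Fin n` in the sense of Aizenman–Duminil-Copin 2021, §2 (block graph `ℤᵈ × 𝒦_N`, p. 7). [cite: AizenmanDuminilCopinAnnals2021, §2, paragraph after Def. 2.1 (p. 7)] -/
theorem weightedMagnetization_mul_weightedMagnetization {n : ℕ} (J : ℝ) (w : Fin n → ℝ)
    (s t : Fin n → Bool) :
    J * (weightedMagnetization w s * weightedMagnetization w t) =
      ∑ i, ∑ j, (J * (w i * w j)) * (spinVal s i * spinVal t j) := by
  rw [weightedMagnetization, weightedMagnetization, Finset.sum_mul_sum, Finset.mul_sum]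
  refine Finset.sum_congr rfl fun i _ => ?_
  rw [Finset.mul_sum]
  exact Finset.sum_congr rfl fun j _ => by ring

end BlockIsing

end Literature.MathematicalPhysics.QuantumLattice

end
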